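import Summits.Ventures.GridStability.Bench.NE39SPSlabCIdS2
import Literature.Computation.Certificates.Blocks

/-!
# GridStability/Bench/NE39SPSlabCRoa — «G2-Q NE39SP SLAB»: a kernel-checked Lur'e–Postnikov SLAB (S-procedure + POPOV)
# certificate for the 49-node structure-preserving New England model relative to bus 39 (58 states, 56 lines), and
# its certified region (ε-level)

Cell `gridfusion` (LADDER-GRIDFUSION), SP–Lur'e lane, row «G2-Q NE39SP SLAB» (n = 58 structure-preserving quadratic-tier
kernel row; lead R-G2-WAVE1 (b)(iii), R-SP9-ROW AMENDMENT); seat gridfusion-model-2 (g6). OBJECT `NE39SP.relLurie D`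
(p494720), D = `1/10` uniform SYNTHETIC (R-SPCERT token); CERTIFICATE = sos-4's STRUCTURED-P («nbr», clique route) slab certificate cert/sos-4/j272825/lchord-R5-NE39SP-D1o10-nbr-csJ.json 3f9f274c5104abf6
(lead RULING (R-a) AMENDED 08:21:56Z, row candidate «G2.b-NE39SP-SLAB-CLQ» #53; slab `u = 1/4`, `γ_lo = 97/200`, `a = 5/8`, `b = 1`, `η = 1/1000`, `ε_P = 479/2²⁴`), data `Lyapunov/NE39SPSlabCData` (model-2's exact copy of sos-4's structured-P hand-over 5a053876f8a67723, re-checked by kit j273502: −slabMatrix and P − ε1 equal entry by entry; json models/NE39SP-slabC-instance.json 0350c97bce3d88be); PSD side = sos-4's clique Gram files + lit-6's CliqueBlockEmbedding glue. LABEL: pipeline object on a structure-preserving NE39 VARIANT with DECLARED SYNTHETIC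
DAMPING — not a sentence about the printed New England system (MODEL-VALIDITY v0.33 R-SPCERT).
WHAT IS PROVED: `idAllS` / `negLQ_eq` (the 114 × 114 identity `−𝓛 = AqS` assembled from the sparse row blocks), `certOf hP hA :
SlabCertificate (NE39SP.relLurie D)` (lit-6 p497347 [cite: Pai1981, §2.16 Theorem [18] eqs. (2.63)–(2.64)];
the two PosSemidef facts `((PSq − ε•1).map cast).PosSemidef` and `(AqS.map cast).PosSemidef` enter as HYPOTHESES `hP`, `hA` — they are
DISCHARGED by sos-4's kernel-decided CLIQUE Gram certificates (lit-6's `CliqueBlockEmbedding` glue, importing p514683) in the 3-line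
assembly file `Bench/NE39SPSlabCMain.lean`; this file is therefore CLOSED MODULO exactly those two facts and nothing else), and
**`ne39_slab_roa_of hP hA`** = `NE39SP.slab_roa_of_eps` (p500843) with `u = 1/4`, `γ_lo = 97/200`, `c = ε·γ_lo²/2`:
**for MODEL M′_D = `(NE39SP.params D).phaseField`: from every phase point whose 56 listed line-angle deviations
satisfy `|σ_e − σ*_e| ≤ 97/200` and whose relative state has `V ≤ c`, a solution exists and EVERY solution keeps
`|σ_e(t) − σ*_e| < 2·atan(1/4)` and `V ≤ c` for all `t ≥ 0`, all 49·48 bus-angle differences tend to the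
equilibrium's and all ten machine frequency deviations tend to `0`.** THREE COLUMNS. CERTIFIED: that sentence,
CLASS slab `u = 1/4` (28.07°), `γ_lo = 97/200`, ε-level `c = 4506911/1342177280000`. MODELLED: «MV-3 + lossless
+ MV-P + D⟨declared: SYNTHETIC uniform D′ = 1/10⟩ + 60-Hz base (ω_s := 377) + V-frozen(LF) + |E|′(h12) + ref bus 39;
pipeline object with DECLARED SYNTHETIC DAMPING (machine D′/M ∈ [0.038, 0.78] s⁻¹ = 37.7× the printed generic
prime-mover coefficient)». VALIDATED: sos-4's chordal SDP (CLARABEL, Jacobi scaling) + model-2's exact rational re-match (kit j273502); region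
datum: ε-level inner relative-state ball ≈ 0.01° — a kernel-EXISTENCE datum, feasibility-grade, NOT optimised (the
level-optimised object 033ca4741cd2bb31, ball ≈ 0.22°, is rider «#53′ REGION», lead RULING #53 OBJECT 08:38:22Z). Nothing here says the
New England system or any grid is stable.
-/

noncomputable section

open Set Filter Topology Real Matrix
open Literature.MathematicalPhysics.PowerSystems
open Literature.MathematicalPhysics.PowerSystems.LyapunovFunctionFamily
open Literature.Computation.Certificates
open Summit.Ventures.GridStability.Models
open Summit.Ventures.GridStability.Models.StructurePreserving
open Summit.Ventures.GridStability.Models.NE39SP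
open Summit.Ventures.GridStability.Lyapunov.NE39SPSlabC

namespace Summit.Ventures.GridStability.Bench.NE39SPSlabC

/-! ### Cast plumbing -/

/-- `(M·N) ↦ ℝ` (plumbing). -/
private theorem map_mul' {m n o : Type*} [Fintype n] (M : Matrix m n ℚ) (N : Matrix n o ℚ) :
    (M * N).map (Rat.cast : ℚ → ℝ) = M.map (Rat.cast : ℚ → ℝ) * N.map (Rat.cast : ℚ → ℝ) :=
  Matrix.map_mul (f := Rat.castHom ℝ)
/-- `(M+N) ↦ ℝ` (plumbing). -/
private theorem map_add' {m n : Type*} (M N : Matrix m n ℚ) :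
    (M + N).map (Rat.cast : ℚ → ℝ) = M.map (Rat.cast : ℚ → ℝ) + N.map (Rat.cast : ℚ → ℝ) := by
  ext i j; simp
/-- `(M−N) ↦ ℝ` (plumbing). -/
private theorem map_sub' {m n : Type*} (M N : Matrix m n ℚ) :
    (M - N).map (Rat.cast : ℚ → ℝ) = M.map (Rat.cast : ℚ → ℝ) - N.map (Rat.cast : ℚ → ℝ) := by
  ext i j; simp
/-- `(−M) ↦ ℝ` (plumbing). -/
private theorem map_neg' {m n : Type*} (M : Matrix m n ℚ) :
    (-M).map (Rat.cast : ℚ → ℝ) = -M.map (Rat.cast : ℚ → ℝ) := by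
  ext i j; simp
/-- transpose commutes with the cast (plumbing). -/
private theorem map_transpose' {m n : Type*} (M : Matrix m n ℚ) :
    Mᵀ.map (Rat.cast : ℚ → ℝ) = (M.map (Rat.cast : ℚ → ℝ))ᵀ := rfl
/-- `diag(d) ↦ ℝ` (plumbing). -/
private theorem map_diagonal' {n : Type*} [DecidableEq n] (d : n → ℚ) :
    (Matrix.diagonal d).map (Rat.cast : ℚ → ℝ) = Matrix.diagonal (fun i => (d i : ℝ)) :=
  Matrix.diagonal_map Rat.cast_zero
/-- `(q·1) ↦ ℝ` (plumbing). -/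
private theorem map_smul_one' {n : Type*} [DecidableEq n] (q : ℚ) :
    (q • (1 : Matrix n n ℚ)).map (Rat.cast : ℚ → ℝ) = (q : ℝ) • (1 : Matrix n n ℝ) := by
  ext i j
  by_cases h : i = j
  · subst h; simp
  · simp [h]

/-! ### The identity `−𝓛 = AqS` assembled -/

/-- all 114 rows of the identity (sparse form). -/
theorem idAllS : ∀ p : Fin 114, IdRowS p :=
  forall_fin_of_blocks 3 (by norm_num) fun c => by
    fin_cases c
    exacts [ids_0, ids_1, ids_2, ids_3, ids_4, ids_5, ids_6, ids_7, ids_8, ids_9, ids_10, ids_11, ids_12, ids_13, ids_14, ids_15, ids_16, ids_17, ids_18, ids_19, ids_20, ids_21, ids_22, ids_23, ids_24, ids_25, ids_26, ids_27, ids_28, ids_29, ids_30, ids_31, ids_32, ids_33, ids_34, ids_35, ids_36, ids_37]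

/-- **`−𝓛 = AqS` (reindexed)** over `ℚ`. -/
theorem negLQ_eq : negLQ = AqS.submatrix e2 e2 := by
  rw [negLQ_eq_negLS]
  ext a b
  have h := idAllS (e2 a) (e2 b)
  simpa [Matrix.submatrix] using h

/-! ### The certificate data over `ℝ` and the certificate -/

/-- `P` (real). -/
def P : Matrix (Fin 48 ⊕ Fin 10) (Fin 48 ⊕ Fin 10) ℝ := PQB.map (Rat.cast : ℚ → ℝ)
/-- `τ` (real). -/
def tauR : Fin 56 → ℝ := fun e => (tauSQ e : ℝ)
/-- `λ` (real). -/
def lamR : Fin 56 → ℝ := fun e => (lamSQ e : ℝ)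
/-- `a = 5/8`. -/
def aR : Fin 56 → ℝ := fun _ => (aSQ : ℝ)
/-- `b = 1`. -/
def bR : Fin 56 → ℝ := fun _ => 1

set_option maxHeartbeats 800000 in
/-- **THE NE39SP SLAB CERTIFICATE, modulo the two PSD facts** (sos-4's clique-structured data; CB ≠ 0 terms included):
lit-6's `SlabCertificate` on `NE39SP.relLurie D`, given `hP : P − ε1 ⪰ 0` and `hA : AqS ⪰ 0` over `ℝ`. [cite: Pai1981, §2.16 Theorem [18] eqs. (2.63)–(2.64); VuTuritsyn2017, §4.2 Lemma 1] -/
def certOf (hP : ((PSq - epsSQ • (1 : Matrix (Fin 58) (Fin 58) ℚ)).map (Rat.cast : ℚ → ℝ)).PosSemidef)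
    (hA : (AqS.map (Rat.cast : ℚ → ℝ)).PosSemidef) : SlabCertificate (NE39SP.relLurie D) where
  P := P
  ε := (epsSQ : ℝ)
  η := (etaSQ : ℝ)
  τ := tauR
  lam := lamR
  a := aR
  b := bR
  P_symm := by
    have ht : PQBᵀ = PQB := by
      ext a b
      exact PSq_symm (e1 b) (e1 a)
    show (PQB.map (Rat.cast : ℚ → ℝ))ᵀ = PQB.map (Rat.cast : ℚ → ℝ)
    rw [← map_transpose', ht]
  ε_pos := by exact_mod_cast scalar_facts.2.1
  η_pos := by exact_mod_cast scalar_facts.2.2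
  P_ge := by
    have hsub : P - (epsSQ : ℝ) • (1 : Matrix (Fin 48 ⊕ Fin 10) (Fin 48 ⊕ Fin 10) ℝ)
        = ((PSq - epsSQ • (1 : Matrix (Fin 58) (Fin 58) ℚ)).map (Rat.cast : ℚ → ℝ)).submatrix e1 e1 := by
      ext i j
      by_cases h : i = j
      · subst h; simp [P, PQB]
      · have h' : e1 i ≠ e1 j := fun he => h (e1.injective he)
        simp [P, PQB, h, h']
    rw [hsub]
    exact (Matrix.posSemidef_submatrix_equiv e1).2 hP
  τ_nonneg := fun e => by unfold tauR; exact_mod_cast (mult_nonneg e).1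
  lam_nonneg := fun e => by unfold lamR; exact_mod_cast (mult_nonneg e).2
  a_nonneg_of_lam_pos := fun e _ => by unfold aR aSQ; norm_num
  lmi := by
    have hd : Matrix.diagonal (fun k => tauR k * (aR k * bR k)) = (Matrix.diagonal tabQ).map (Rat.cast : ℚ → ℝ) := by
      rw [map_diagonal']; congr 1; funext k; simp [tauR, aR, bR, tabQ]
    have hd1 : Matrix.diagonal lamR = (Matrix.diagonal lamSQ).map (Rat.cast : ℚ → ℝ) := by
      rw [map_diagonal']; rfl
    have hd2 : Matrix.diagonal (fun k => tauR k * (aR k + bR k) / 2)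
        = (Matrix.diagonal tab2Q).map (Rat.cast : ℚ → ℝ) := by
      rw [map_diagonal']; congr 1; funext k; simp [tauR, aR, bR, tab2Q]
    have hd3 : Matrix.diagonal tauR = (Matrix.diagonal tauSQ).map (Rat.cast : ℚ → ℝ) := by
      rw [map_diagonal']; rfl
    have h11 : slabL11 (NE39SP.relLurie D) P (etaSQ : ℝ) tauR aR bR = L11Q.map (Rat.cast : ℚ → ℝ) := by
      rw [slabL11, A_eq, C_eq, hd, P, L11Q]
      simp only [map_sub', map_add', map_mul', map_transpose', map_smul_one']
    have h12 : slabL12 (NE39SP.relLurie D) P lamR tauR aR bR = L12Q.map (Rat.cast : ℚ → ℝ) := by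
      rw [slabL12, A_eq, B_eq, C_eq, hd1, hd2, P, L12Q]
      simp only [map_add', map_neg', map_mul', map_transpose']
    have h22 : slabL22 (NE39SP.relLurie D) lamR tauR = L22Q.map (Rat.cast : ℚ → ℝ) := by
      rw [slabL22, B_eq, C_eq, hd1, hd3, L22Q]
      simp only [map_sub', map_neg', map_mul', map_transpose']
    have hneg : -(slabMatrix (NE39SP.relLurie D) P (etaSQ : ℝ) lamR tauR aR bR)
        = (AqS.map (Rat.cast : ℚ → ℝ)).submatrix e2 e2 := by
      rw [slabMatrix, h11, h12, h22, ← map_transpose', ← Matrix.fromBlocks_map, ← map_neg']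
      show negLQ.map (Rat.cast : ℚ → ℝ) = _
      rw [negLQ_eq]
      rfl
    rw [hneg]
    exact (Matrix.posSemidef_submatrix_equiv e2).2 hA

/-! ### The sentence (ε-level) -/

/-- **«G2.b-NE39SP-SLAB-CLQ» — certified region of the 49-node structure-preserving New England model with DECLARED
SYNTHETIC damping `D′ = 1/10`, slab class `u = 1/4`, ε-level — MODULO the two PosSemidef facts `hP`, `hA` (discharged by
sos-4's clique Gram certificates in `Bench/NE39SPSlabCMain.lean`).** For every phase point `y = (δ, ω)` of MODEL M′_D =
`(NE39SP.params D).phaseField` whose 56 listed line-angle deviations satisfy `|σ_e − σ*_e| ≤ 97/200` and whose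
relative state has `V(relState y) ≤ 4506911/1342177280000` (`V = xᵀPx + 2Σ λ_e∫F_e` of `certOf hP hA`): a solution from
`y` exists (unique by `phaseSolution_unique`) and EVERY solution keeps `|σ_e(t) − σ*_e| < 2·atan(1/4)` and `V ≤ c`
for all `t ≥ 0`, every bus-angle difference `δ_v − δ_w → δ₀_v − δ₀_w`, every machine frequency deviation `ω_v → 0`.
CERTIFIED for MODEL M′_D; MODELLED / VALIDATED as in the header; pipeline object, not a sentence about the printed
New England system. [cite: Pai1981, §2.16 Theorem [18] and §4.6–§4.7; VuTuritsyn2017, §4.3 Theorem 1] -/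
theorem ne39_slab_roa_of
    (hP : ((PSq - epsSQ • (1 : Matrix (Fin 58) (Fin 58) ℚ)).map (Rat.cast : ℚ → ℝ)).PosSemidef)
    (hA : (AqS.map (Rat.cast : ℚ → ℝ)).PosSemidef) {y : (Fin 49 → ℝ) × (Fin 49 → ℝ)}
    (hy : ∀ e, |(y.1 (srcV e) - y.1 (tgtV e)) - (δ₀ (srcV e) - δ₀ (tgtV e))| ≤ (97 : ℝ) / 200)
    (hyc : (certOf hP hA).V (relState ref gnode δ₀ y) ≤ (4506911 : ℝ) / 1342177280000) :
    (∃ X : ℝ → (Fin 49 → ℝ) × (Fin 49 → ℝ), X 0 = y ∧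
        ∀ T : ℝ, ∀ t ∈ Icc 0 T, HasDerivWithinAt X ((NE39SP.params D).phaseField (X t)) (Icc 0 T) t) ∧
      ∀ X : ℝ → (Fin 49 → ℝ) × (Fin 49 → ℝ), X 0 = y →
        (∀ T : ℝ, ∀ t ∈ Icc 0 T, HasDerivWithinAt X ((NE39SP.params D).phaseField (X t)) (Icc 0 T) t) →
        (∀ t, 0 ≤ t →
            (∀ e, |((X t).1 (srcV e) - (X t).1 (tgtV e)) - (δ₀ (srcV e) - δ₀ (tgtV e))|
              < 2 * Real.arctan ((1 / 4 : ℚ) : ℝ)) ∧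
            (certOf hP hA).V (relState ref gnode δ₀ (X t)) ≤ (4506911 : ℝ) / 1342177280000) ∧
          (∀ v w, Tendsto (fun t => (X t).1 v - (X t).1 w) atTop (𝓝 (δ₀ v - δ₀ w))) ∧
          ∀ v ∈ genS, Tendsto (fun t => (X t).2 v) atTop (𝓝 0) := by
  have ha : ∀ e, (certOf hP hA).a e ≤ (slabSlope (1 / 4) : ℝ) := fun e => by
    show ((aSQ : ℚ) : ℝ) ≤ ((slabSlope (1 / 4) : ℚ) : ℝ)
    exact_mod_cast (show aSQ ≤ slabSlope (1 / 4) by norm_num [aSQ, slabSlope, tauLF])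
  have hb1 : ∀ e, (1 : ℝ) ≤ (certOf hP hA).b e := fun _ => le_refl _
  have hc : 2 * ((cEpsSQ : ℚ) : ℝ) ≤ (certOf hP hA).ε * (((97 / 200 : ℚ)) : ℝ) ^ 2 := by
    show 2 * ((cEpsSQ : ℚ) : ℝ) ≤ ((epsSQ : ℚ) : ℝ) * (((97 / 200 : ℚ)) : ℝ) ^ 2
    exact_mod_cast scalar_facts.1
  have hlev : ((cEpsSQ : ℚ) : ℝ) = (4506911 : ℝ) / 1342177280000 := by norm_num [cEpsSQ]
  have hglo : (((97 / 200 : ℚ)) : ℝ) = (97 : ℝ) / 200 := by norm_num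
  have hy' : ∀ e, |(y.1 (srcV e) - y.1 (tgtV e)) - (δ₀ (srcV e) - δ₀ (tgtV e))| ≤ (((97 / 200 : ℚ)) : ℝ) :=
    fun e => by rw [hglo]; exact hy e
  have hyc' : (certOf hP hA).V (relState ref gnode δ₀ y) ≤ ((cEpsSQ : ℚ) : ℝ) := by rw [hlev]; exact hyc
  have h := NE39SP.slab_roa_of_eps hD (certOf hP hA) (u := 1 / 4) (γlo := 97 / 200) (by norm_num) (by norm_num)
    (by norm_num) (by norm_num) ha hb1 hc hy' hyc'
  rw [hlev] at h
  exact h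

end Summit.Ventures.GridStability.Bench.NE39SPSlabC

end
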